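import Literature.NumberTheory.LFunctions.LatticeLinePieces
import Literature.NumberTheory.LFunctions.GaussianWeylWeights
import Literature.Analysis.Fourier.FresnelConstantValue
import HarnessLib

/-!
# The piece bound in scale form

Topic `Literature/NumberTheory/LFunctions`.  Everything here is PROVED (no definitions except the numerical
constant `VdC.pieceK`).

`VdC.PieceHyp.norm_piece_le` bounds a piece `∑_b ∑_a φ(ad+be) e(F(ad+be))` of a two-dimensional exponential sum
by an explicit but long expression in the twenty-odd constants of `PieceHyp`.  When these constants are
controlled by two scales — `Λ` (the size of the second derivatives of the phase) and `R` (the size of the piece),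
together with the size `g` of the weight — in the way they are for the Gaussian lattice sums
(`r ≍ Λ`, `A = O(1)`, `λ₃ = O(Λ/R)`, `G₁ = O(g/R)`, `G₂ = O(g/R²)`, `L_φ = O(g/R)`, `L₂ = O(Λ/R)`, `ν_m = O(ΛR)`,
`κ₁ ≍ κ₂ ≍ Λ`, chords and index ranges `O(R)`), the bound collapses to

  `‖S‖ ≤ K · C_S² · (log(1 + ΛR²) + 4) · (gR) · (ΛR + Λ²R + 1 + 1/(ΛR))`      (`VdC.PieceHyp.norm_piece_le_scale`)

with an absolute constant `K = pieceK` (`C_S` is the constant of the smooth step from `GaussianWeylWeights`).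
For the undifferenced Gaussian pieces (`g = 4/R`, `Λ = W/R²`) this is `O(W/R + W²/R³ + 1 + R/W)` up to the
logarithm, and for the differenced ones (`g = 16/R²`, `Λ = 3|h|W/R³`) it is `O((1/R)(…))`.

## References

* E. C. Titchmarsh, *The lattice-points in a circle*, Proc. London Math. Soc. (2) 38 (1935), 96–115.
  [Titchmarsh1935Lattice]
* E. Krätzel, *Lattice Points*, Kluwer 1988, §2.2. [Kratzel1988]
-/

noncomputable section

open Finset Real Set Metric Classical

namespace Literature.NumberTheory.LFunctions
namespace VdC

open Literature.Analysis.Fourier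

/-! ### Numerical lemmas -/

/-- `‖𝔣‖ = (2π)^{1/2} ≤ 3`. [folklore] -/
theorem norm_fresnelC_le_three : ‖_root_.Literature.Analysis.Fourier.fresnelC‖ ≤ 3 := by
  rw [norm_fresnelC]
  rw [Real.sqrt_le_left (by norm_num)]
  nlinarith [Real.pi_lt_d2]

/-- `log 37 ≤ 4`. [folklore] -/
theorem log_37_le_four : Real.log 37 ≤ 4 := by
  have h1 : (37 : ℝ) ≤ Real.exp 4 := by
    have h := Real.exp_one_gt_d9
    have : Real.exp 4 = Real.exp 1 ^ 4 := by rw [← Real.exp_nat_mul]; norm_num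
    rw [this]
    have h4 := pow_lt_pow_left₀ h (by norm_num) (by norm_num : (4 : ℕ) ≠ 0)
    norm_num at h4
    linarith
  calc Real.log 37 ≤ Real.log (Real.exp 4) := Real.log_le_log (by norm_num) h1
    _ = 4 := Real.log_exp 4

/-- `√y ≤ 1 + y` for `y ≥ 0`. [folklore] -/
theorem sqrt_le_one_add {y : ℝ} (hy : 0 ≤ y) : Real.sqrt y ≤ 1 + y := by
  calc Real.sqrt y ≤ Real.sqrt ((1 + y) ^ 2) := Real.sqrt_le_sqrt (by nlinarith)
    _ = 1 + y := Real.sqrt_sq (by linarith)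

/-- `1/√y ≤ 1 + 1/y` for `y > 0`. [folklore] -/
theorem one_div_sqrt_le {y : ℝ} (hy : 0 < y) : 1 / Real.sqrt y ≤ 1 + 1 / y := by
  have hs : 0 < Real.sqrt y := Real.sqrt_pos.2 hy
  rcases le_or_gt 1 y with h | h
  · have : 1 ≤ Real.sqrt y := by rw [Real.le_sqrt (by norm_num) hy.le]; linarith
    have hy' : 0 ≤ 1 / y := by positivity
    calc 1 / Real.sqrt y ≤ 1 := by rw [div_le_one hs]; exact this
      _ ≤ 1 + 1 / y := by linarith
  · have h1 : y ≤ Real.sqrt y := by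
      have := Real.sqrt_le_sqrt (le_of_lt h) ; rw [Real.sqrt_one] at this
      calc y = Real.sqrt y * Real.sqrt y := (Real.mul_self_sqrt hy.le).symm
        _ ≤ Real.sqrt y * 1 := mul_le_mul_of_nonneg_left this hs.le
        _ = Real.sqrt y := mul_one _
    calc 1 / Real.sqrt y ≤ 1 / y := div_le_div_of_nonneg_left zero_le_one hy h1
      _ ≤ 1 + 1 / y := by linarith

/-- `1/(2πr) ≤ 64/Λ` when `Λ/400 ≤ r`. [folklore] -/
theorem inv_two_pi_r_le {Λ r : ℝ} (hΛ : 0 < Λ) (hr : Λ / 400 ≤ r) : 1 / (2 * π * r) ≤ 64 / Λ := by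
  have hπ := Real.pi_gt_d2
  have hr0 : 0 < r := lt_of_lt_of_le (by positivity) hr
  rw [div_le_div_iff₀ (by positivity) hΛ]
  nlinarith

/-- `1/√(2πr) ≤ 8/√Λ` when `Λ/400 ≤ r`. [folklore] -/
theorem inv_sqrt_two_pi_r_le {Λ r : ℝ} (hΛ : 0 < Λ) (hr : Λ / 400 ≤ r) :
    1 / Real.sqrt (2 * π * r) ≤ 8 / Real.sqrt Λ := by
  have hπ := Real.pi_gt_d2
  have hr0 : 0 < r := lt_of_lt_of_le (by positivity) hr
  have hsΛ : 0 < Real.sqrt Λ := Real.sqrt_pos.2 hΛ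
  have h1 : Real.sqrt Λ ≤ 8 * Real.sqrt (2 * π * r) := by
    rw [show (8 : ℝ) = Real.sqrt 64 by rw [show (64 : ℝ) = 8 ^ 2 by norm_num, Real.sqrt_sq (by norm_num)],
      ← Real.sqrt_mul (by norm_num)]
    exact Real.sqrt_le_sqrt (by nlinarith)
  rw [div_le_div_iff₀ (Real.sqrt_pos.2 (by positivity)) hsΛ]
  linarith

/-- `√(2πr) ≤ 4√Λ` when `r ≤ 2Λ`. [folklore] -/
theorem sqrt_two_pi_r_le {Λ r : ℝ} (hΛ : 0 < Λ) (hr : r ≤ 2 * Λ) : Real.sqrt (2 * π * r) ≤ 4 * Real.sqrt Λ := by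
  have hπ := Real.pi_lt_d2
  rw [show (4 : ℝ) = Real.sqrt 16 by rw [show (16 : ℝ) = 4 ^ 2 by norm_num, Real.sqrt_sq (by norm_num)],
    ← Real.sqrt_mul (by norm_num)]
  exact Real.sqrt_le_sqrt (by nlinarith [Real.pi_pos])

/-- The logarithm of the `B`-process in scale form: `log(1 + ℓ√(2πr)) ≤ log(1 + ΛR²) + 4` for `ℓ ≤ 9R`, `r ≤ 2Λ`.
[folklore] -/
theorem log_B_le {Λ r ℓ R : ℝ} (hΛ : 0 < Λ) (hR : 1 ≤ R) (hr0 : 0 < r) (hr : r ≤ 2 * Λ) (hℓ0 : 0 ≤ ℓ) (hℓ : ℓ ≤ 9 * R) :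
    Real.log (1 + ℓ * Real.sqrt (2 * π * r)) ≤ Real.log (1 + Λ * R ^ 2) + 4 := by
  have hs := sqrt_two_pi_r_le hΛ hr
  have hsΛ : 0 ≤ Real.sqrt Λ := Real.sqrt_nonneg _
  have h1 : ℓ * Real.sqrt (2 * π * r) ≤ 36 * (R * Real.sqrt Λ) := by
    calc ℓ * Real.sqrt (2 * π * r) ≤ (9 * R) * (4 * Real.sqrt Λ) :=
          mul_le_mul hℓ hs (Real.sqrt_nonneg _) (by positivity)
      _ = 36 * (R * Real.sqrt Λ) := by ring
  have h2 : R * Real.sqrt Λ ≤ 1 + Λ * R ^ 2 := by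
    have : R * Real.sqrt Λ = Real.sqrt (Λ * R ^ 2) := by
      rw [Real.sqrt_mul hΛ.le, Real.sqrt_sq (by linarith)]; ring
    rw [this]; exact sqrt_le_one_add (by positivity)
  have h3 : 1 + ℓ * Real.sqrt (2 * π * r) ≤ 37 * (1 + Λ * R ^ 2) := by nlinarith [hΛ, sq_nonneg R]
  have h0 : 0 < 1 + ℓ * Real.sqrt (2 * π * r) := by positivity
  calc Real.log (1 + ℓ * Real.sqrt (2 * π * r)) ≤ Real.log (37 * (1 + Λ * R ^ 2)) := Real.log_le_log h0 h3
    _ = Real.log 37 + Real.log (1 + Λ * R ^ 2) := Real.log_mul (by norm_num) (by positivity)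
    _ ≤ _ := by linarith [log_37_le_four]

/-- The absolute constant of the scale bound. [folklore] -/
@[irreducible] def pieceK : ℝ := 10 ^ 22

/-! ### The line error in scale form (pure real inequalities) -/

section LineErrScale

variable {r A lam3 G G₁ G₂ Λ R g ℓ : ℝ}

set_option maxHeartbeats 400000 in
/-- The `E₁, E₂` part of the line error in scale form. [folklore] -/
theorem scale_E (hr : 0 < r) (hA1 : 1 ≤ A) (hG0 : 0 ≤ G) (hlam3 : 0 ≤ lam3) (hG₁0 : 0 ≤ G₁)
    (hR : 1 ≤ R) (hΛ : 0 < Λ) (hg : G ≤ g)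
    (hr1 : Λ / 400 ≤ r) (hAr : A * r ≤ 2 * Λ) (hA : A ≤ 400) (hl3 : lam3 ≤ 8 * Λ / R)
    (hG1 : G₁ ≤ 300 * stepC * g / R) (hℓ0 : 0 ≤ ℓ) (hℓ : ℓ ≤ 9 * R) :
    (A * r * ℓ + 1) *
        (G * (2 * A ^ 3 * (2 * π * lam3 / (2 * π * r) ^ 2) * (2 + 2 * Real.log (1 + ℓ * Real.sqrt (2 * π * r))))
          + G₁ / (2 * π * r) * (10 + 4 * A * Real.log (1 + ℓ * Real.sqrt (2 * π * r))))
      + 2 * (G₁ / (2 * π * r) * (3 + (1 + A) * Real.log (1 + ℓ * Real.sqrt (2 * π * r))))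
      ≤ 13 * 10 ^ 14 * stepC * (g * (Real.log (1 + Λ * R ^ 2) + 4))
        + 8 * 10 ^ 13 * stepC * (g * (Real.log (1 + Λ * R ^ 2) + 4) / (Λ * R)) := by
  have hπ := Real.pi_gt_d2
  have hC := one_le_stepC
  have hA0 : 0 ≤ A := by linarith
  have hg0 : 0 ≤ g := hG0.trans hg
  have hR0 : 0 < R := by linarith
  have hr2 : r ≤ 2 * Λ := by nlinarith
  have hΛR : 0 < Λ * R := by positivity
  set LW := Real.log (1 + Λ * R ^ 2) + 4 with hLW
  have hLW1 : 4 ≤ LW := by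
    have : 0 ≤ Real.log (1 + Λ * R ^ 2) := Real.log_nonneg (by nlinarith [sq_nonneg R])
    linarith
  set L := Real.log (1 + ℓ * Real.sqrt (2 * π * r)) with hL
  have hL0 : 0 ≤ L := Real.log_nonneg (by nlinarith [Real.sqrt_nonneg (2 * π * r)])
  have hLLW : L ≤ LW := log_B_le hΛ hR hr hr2 hℓ0 hℓ
  have h1r : 1 / (2 * π * r) ≤ 64 / Λ := inv_two_pi_r_le hΛ hr1
  have h1r' : 1 / r ≤ 400 / Λ := by rw [div_le_div_iff₀ hr hΛ]; linarith
  set X := g * LW / (Λ * R) with hX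
  have hX0 : 0 ≤ X := by positivity
  have hXC : X ≤ stepC * X := le_mul_of_one_le_left hX0 hC
  -- `q₁ = 2πλ₃/(2πr)² ≤ 204800/(ΛR)`
  have hq1 : 2 * π * lam3 / (2 * π * r) ^ 2 ≤ 204800 / (Λ * R) := by
    have e1 : 2 * π * lam3 / (2 * π * r) ^ 2 = lam3 * (1 / (2 * π * r)) * (1 / r) := by
      field_simp
    rw [e1]
    calc lam3 * (1 / (2 * π * r)) * (1 / r) ≤ (8 * Λ / R) * (64 / Λ) * (400 / Λ) := by gcongr
      _ = 204800 / (Λ * R) := by field_simp; ring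
  have hE1a : G * (2 * A ^ 3 * (2 * π * lam3 / (2 * π * r) ^ 2) * (2 + 2 * L)) ≤ 66 * 10 ^ 12 * X := by
    calc G * (2 * A ^ 3 * (2 * π * lam3 / (2 * π * r) ^ 2) * (2 + 2 * L))
        ≤ g * (2 * 400 ^ 3 * (204800 / (Λ * R)) * (2 + 2 * LW)) := by gcongr
      _ ≤ g * (2 * 400 ^ 3 * (204800 / (Λ * R)) * ((5 / 2) * LW)) := by gcongr; linarith
      _ = 65536 * 10 ^ 9 * X := by rw [hX]; field_simp; ring
      _ ≤ 66 * 10 ^ 12 * X := by rw [show (65536 * 10 ^ 9 : ℝ) = 65536 / 1000 * 10 ^ 12 by norm_num]; nlinarith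
  have hG1r : G₁ / (2 * π * r) ≤ 19200 * stepC * (g / (Λ * R)) := by
    rw [div_eq_mul_one_div G₁]
    calc G₁ * (1 / (2 * π * r)) ≤ (300 * stepC * g / R) * (64 / Λ) := by gcongr
      _ = 19200 * stepC * (g / (Λ * R)) := by field_simp; ring
  have hG1r0 : 0 ≤ G₁ / (2 * π * r) := by positivity
  have hE1b : G₁ / (2 * π * r) * (10 + 4 * A * L) ≤ 31 * 10 ^ 6 * (stepC * X) := by
    calc G₁ / (2 * π * r) * (10 + 4 * A * L) ≤ (19200 * stepC * (g / (Λ * R))) * (10 + 4 * 400 * LW) := by gcongr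
      _ ≤ (19200 * stepC * (g / (Λ * R))) * (1603 * LW) := by gcongr; linarith
      _ = 307776 / 10 ^ 4 * 10 ^ 6 * (stepC * X) := by rw [hX]; field_simp; ring
      _ ≤ 31 * 10 ^ 6 * (stepC * X) := by nlinarith [mul_nonneg (by linarith : (0:ℝ) ≤ stepC) hX0]
  have hE2 : G₁ / (2 * π * r) * (3 + (1 + A) * L) ≤ 78 * 10 ^ 5 * (stepC * X) := by
    calc G₁ / (2 * π * r) * (3 + (1 + A) * L) ≤ (19200 * stepC * (g / (Λ * R))) * (3 + (1 + 400) * LW) := by gcongr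
      _ ≤ (19200 * stepC * (g / (Λ * R))) * (402 * LW) := by gcongr; linarith
      _ = 77184 / 10 ^ 4 * 10 ^ 6 * (stepC * X) := by rw [hX]; field_simp; ring
      _ ≤ 78 * 10 ^ 5 * (stepC * X) := by nlinarith [mul_nonneg (by linarith : (0:ℝ) ≤ stepC) hX0]
  have hE1 : G * (2 * A ^ 3 * (2 * π * lam3 / (2 * π * r) ^ 2) * (2 + 2 * L)) + G₁ / (2 * π * r) * (10 + 4 * A * L)
      ≤ 7 * 10 ^ 13 * (stepC * X) := by linarith
  have hE10 : 0 ≤ G * (2 * A ^ 3 * (2 * π * lam3 / (2 * π * r) ^ 2) * (2 + 2 * L))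
      + G₁ / (2 * π * r) * (10 + 4 * A * L) := by positivity
  have hArl : A * r * ℓ + 1 ≤ 18 * (Λ * R) + 1 := by
    have := mul_le_mul hAr hℓ hℓ0 (by positivity)
    linarith
  have hP1 : (A * r * ℓ + 1) *
        (G * (2 * A ^ 3 * (2 * π * lam3 / (2 * π * r) ^ 2) * (2 + 2 * L)) + G₁ / (2 * π * r) * (10 + 4 * A * L))
      ≤ (18 * (Λ * R) + 1) * (7 * 10 ^ 13 * (stepC * X)) := mul_le_mul hArl hE1 hE10 (by positivity)
  have e1 : (18 * (Λ * R) + 1) * (7 * 10 ^ 13 * (stepC * X))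
      = 126 * 10 ^ 13 * stepC * (g * LW) + 7 * 10 ^ 13 * stepC * X := by rw [hX]; field_simp; ring
  have hfin : 126 * 10 ^ 13 * stepC * (g * LW) + 7 * 10 ^ 13 * stepC * X + 2 * (78 * 10 ^ 5 * (stepC * X))
      ≤ 13 * 10 ^ 14 * stepC * (g * LW) + 8 * 10 ^ 13 * stepC * X := by
    have : 0 ≤ stepC * (g * LW) := by positivity
    have : 0 ≤ stepC * X := by positivity
    nlinarith
  rw [hX] at hfin e1
  linarith [hP1, hE2, hfin, e1]

set_option maxHeartbeats 400000 in
/-- The tail part of the line error in scale form. [folklore] -/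
theorem scale_tail (hr : 0 < r) (hA1 : 1 ≤ A) (hG0 : 0 ≤ G) (hlam3 : 0 ≤ lam3) (hG₁0 : 0 ≤ G₁) (hG₂0 : 0 ≤ G₂)
    (hR : 1 ≤ R) (hΛ : 0 < Λ) (hg : G ≤ g)
    (hAr : A * r ≤ 2 * Λ) (hl3 : lam3 ≤ 8 * Λ / R)
    (hG1 : G₁ ≤ 300 * stepC * g / R) (hG2 : G₂ ≤ 80000 * stepC ^ 2 * g / R ^ 2) (hℓ : ℓ ≤ 9 * R) :
    bTail 0 ℓ r A lam3 G G₁ G₂ (2 * π)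
      ≤ 20025 * stepC ^ 2 * (g / R) + 506 * stepC * (g * Λ) + 9 * (g * Λ ^ 2 * R) := by
  have hπ := Real.pi_gt_d2
  have hπ' := Real.pi_lt_d2
  have hC := one_le_stepC
  have hA0 : 0 ≤ A := by linarith
  have hg0 : 0 ≤ g := hG0.trans hg
  have hR0 : 0 < R := by linarith
  have m3 : 0 ≤ g / R := by positivity
  have m4 : 0 ≤ g * Λ := by positivity
  have hD2 : (36 : ℝ) ≤ (2 * π) ^ 2 := by nlinarith
  have hD3 : (216 : ℝ) ≤ (2 * π) ^ 3 := by nlinarith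
  have hD4 : (1296 : ℝ) ≤ (2 * π) ^ 4 := by nlinarith
  have hB2 : 2 * π * A * r ≤ 13 * Λ := by nlinarith
  have hB20 : 0 ≤ 2 * π * A * r := by positivity
  have hB3 : 2 * π * lam3 ≤ 51 * Λ / R := by
    have h1 : 2 * π * lam3 ≤ 2 * π * (8 * Λ / R) := by gcongr
    have h2 : 2 * π * (8 * Λ / R) ≤ 51 * Λ / R := by
      rw [show 2 * π * (8 * Λ / R) = (16 * π) * (Λ / R) by ring, show 51 * Λ / R = 51 * (Λ / R) by ring]
      exact mul_le_mul_of_nonneg_right (by nlinarith) (by positivity)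
    linarith
  have hB30 : 0 ≤ 2 * π * lam3 := by positivity
  have ht1 : G₁ / (2 * π) ^ 2 ≤ 9 * stepC * (g / R) := by
    calc G₁ / (2 * π) ^ 2 ≤ (300 * stepC * g / R) / 36 := by gcongr
      _ = 300 / 36 * (stepC * (g / R)) := by ring
      _ ≤ 9 * stepC * (g / R) := by
          have : 0 ≤ stepC * (g / R) := by positivity
          nlinarith
  have ht2 : G * (2 * π * A * r) / (2 * π) ^ 3 ≤ g * Λ := by
    calc G * (2 * π * A * r) / (2 * π) ^ 3 ≤ g * (13 * Λ) / 216 := by gcongr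
      _ ≤ g * Λ := by rw [div_le_iff₀ (by norm_num : (0:ℝ) < 216)]; nlinarith
  have ht3 : G₂ / (2 * π) ^ 2 ≤ 2223 * stepC ^ 2 * (g / R ^ 2) := by
    calc G₂ / (2 * π) ^ 2 ≤ (80000 * stepC ^ 2 * g / R ^ 2) / 36 := by gcongr
      _ = 80000 / 36 * (stepC ^ 2 * (g / R ^ 2)) := by ring
      _ ≤ 2223 * stepC ^ 2 * (g / R ^ 2) := by
          have : 0 ≤ stepC ^ 2 * (g / R ^ 2) := by positivity
          nlinarith
  have ht4 : 3 * G₁ * (2 * π * A * r) / (2 * π) ^ 3 ≤ 55 * stepC * (g * Λ / R) := by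
    calc 3 * G₁ * (2 * π * A * r) / (2 * π) ^ 3 ≤ 3 * (300 * stepC * g / R) * (13 * Λ) / 216 := by gcongr
      _ = 11700 / 216 * (stepC * (g * Λ / R)) := by ring
      _ ≤ 55 * stepC * (g * Λ / R) := by
          have : 0 ≤ stepC * (g * Λ / R) := by positivity
          nlinarith
  have ht5 : G * (2 * π * lam3) / (2 * π) ^ 3 ≤ g * Λ / R := by
    calc G * (2 * π * lam3) / (2 * π) ^ 3 ≤ g * (51 * Λ / R) / 216 := by gcongr
      _ = 51 / 216 * (g * Λ / R) := by ring
      _ ≤ g * Λ / R := by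
          have : 0 ≤ g * Λ / R := by positivity
          nlinarith
  have ht6 : 3 * G * (2 * π * A * r) ^ 2 / (2 * π) ^ 4 ≤ g * Λ ^ 2 := by
    have hnum : 3 * G * (2 * π * A * r) ^ 2 ≤ 3 * g * (13 * Λ) ^ 2 :=
      mul_le_mul (by linarith) (pow_le_pow_left₀ hB20 hB2 2) (by positivity) (by positivity)
    have hpos : (0 : ℝ) < (2 * π) ^ 4 := by positivity
    calc 3 * G * (2 * π * A * r) ^ 2 / (2 * π) ^ 4 ≤ 3 * g * (13 * Λ) ^ 2 / (2 * π) ^ 4 :=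
          div_le_div_of_nonneg_right hnum hpos.le
      _ ≤ 3 * g * (13 * Λ) ^ 2 / 1296 := div_le_div_of_nonneg_left (by positivity) (by norm_num) hD4
      _ = 507 / 1296 * (g * Λ ^ 2) := by ring
      _ ≤ g * Λ ^ 2 := by
          have : 0 ≤ g * Λ ^ 2 := by positivity
          linarith
  unfold bTail
  rw [sub_zero]
  have hin : G₂ / (2 * π) ^ 2 + 3 * G₁ * (2 * π * A * r) / (2 * π) ^ 3 + G * (2 * π * lam3) / (2 * π) ^ 3
        + 3 * G * (2 * π * A * r) ^ 2 / (2 * π) ^ 4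
      ≤ 2223 * stepC ^ 2 * (g / R ^ 2) + 55 * stepC * (g * Λ / R) + g * Λ / R + g * Λ ^ 2 := by linarith
  have hin0 : 0 ≤ G₂ / (2 * π) ^ 2 + 3 * G₁ * (2 * π * A * r) / (2 * π) ^ 3 + G * (2 * π * lam3) / (2 * π) ^ 3
        + 3 * G * (2 * π * A * r) ^ 2 / (2 * π) ^ 4 := by positivity
  have hℓin : ℓ * (G₂ / (2 * π) ^ 2 + 3 * G₁ * (2 * π * A * r) / (2 * π) ^ 3 + G * (2 * π * lam3) / (2 * π) ^ 3
        + 3 * G * (2 * π * A * r) ^ 2 / (2 * π) ^ 4)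
      ≤ (9 * R) * (2223 * stepC ^ 2 * (g / R ^ 2) + 55 * stepC * (g * Λ / R) + g * Λ / R + g * Λ ^ 2) :=
    mul_le_mul hℓ hin hin0 (by positivity)
  have e : (9 * R) * (2223 * stepC ^ 2 * (g / R ^ 2) + 55 * stepC * (g * Λ / R) + g * Λ / R + g * Λ ^ 2)
      = 20007 * stepC ^ 2 * (g / R) + 495 * stepC * (g * Λ) + 9 * (g * Λ) + 9 * (g * Λ ^ 2 * R) := by
    field_simp; ring
  have u1 : stepC * (g / R) ≤ stepC ^ 2 * (g / R) := by nlinarith [mul_nonneg (by linarith : (0:ℝ) ≤ stepC) m3]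
  have u2 : g * Λ ≤ stepC * (g * Λ) := le_mul_of_one_le_left m4 hC
  linarith [ht1, ht2, hℓin, e, u1, u2]

set_option maxHeartbeats 400000 in
/-- **The line error in scale form**:
`lineErr ≤ 14·10¹⁴ C_S² g LW (1 + 1/(ΛR) + Λ + Λ²R)`, `LW = log(1 + ΛR²) + 4`. [folklore] -/
theorem lineErr_le_scale (hr : 0 < r) (hA1 : 1 ≤ A) (hG0 : 0 ≤ G) (hlam3 : 0 ≤ lam3) (hG₁0 : 0 ≤ G₁)
    (hG₂0 : 0 ≤ G₂) (hR : 1 ≤ R) (hΛ : 0 < Λ) (hg : G ≤ g)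
    (hr1 : Λ / 400 ≤ r) (hAr : A * r ≤ 2 * Λ) (hA : A ≤ 400) (hl3 : lam3 ≤ 8 * Λ / R)
    (hG1 : G₁ ≤ 300 * stepC * g / R) (hG2 : G₂ ≤ 80000 * stepC ^ 2 * g / R ^ 2)
    (hℓ0 : 0 ≤ ℓ) (hℓ : ℓ ≤ 9 * R) :
    lineErr ℓ r A lam3 G G₁ G₂
      ≤ 14 * 10 ^ 14 * stepC ^ 2 * g * (Real.log (1 + Λ * R ^ 2) + 4) * (1 + 1 / (Λ * R) + Λ + Λ ^ 2 * R) := by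
  have hC := one_le_stepC
  have hg0 : 0 ≤ g := hG0.trans hg
  have hR0 : 0 < R := by linarith
  have hΛR : 0 < Λ * R := by positivity
  have hE := scale_E hr hA1 hG0 hlam3 hG₁0 hR hΛ hg hr1 hAr hA hl3 hG1 hℓ0 hℓ
  have hT := scale_tail hr hA1 hG0 hlam3 hG₁0 hG₂0 hR hΛ hg hAr hl3 hG1 hG2 hℓ
  set LW := Real.log (1 + Λ * R ^ 2) + 4 with hLW
  have hLW1 : 4 ≤ LW := by
    have : 0 ≤ Real.log (1 + Λ * R ^ 2) := Real.log_nonneg (by nlinarith [sq_nonneg R])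
    linarith
  unfold lineErr
  have e : 14 * 10 ^ 14 * stepC ^ 2 * g * LW * (1 + 1 / (Λ * R) + Λ + Λ ^ 2 * R)
      = 14 * 10 ^ 14 * (stepC ^ 2 * (g * LW)) + 14 * 10 ^ 14 * (stepC ^ 2 * (g * LW / (Λ * R)))
        + 14 * 10 ^ 14 * (stepC ^ 2 * (g * Λ * LW)) + 14 * 10 ^ 14 * (stepC ^ 2 * (g * Λ ^ 2 * R * LW)) := by
    ring
  rw [e]
  -- compare monomials
  have m1 : 0 ≤ g * LW := by positivity
  have m2 : 0 ≤ g * LW / (Λ * R) := by positivity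
  have m3 : 0 ≤ g / R := by positivity
  have m4 : 0 ≤ g * Λ := by positivity
  have m5 : 0 ≤ g * Λ ^ 2 * R := by positivity
  have hC0 : 0 ≤ stepC := by linarith
  have hC2 : stepC ≤ stepC ^ 2 := by nlinarith
  have v1 : stepC * (g * LW) ≤ stepC ^ 2 * (g * LW) := mul_le_mul_of_nonneg_right hC2 m1
  have v2 : stepC * (g * LW / (Λ * R)) ≤ stepC ^ 2 * (g * LW / (Λ * R)) := mul_le_mul_of_nonneg_right hC2 m2
  have hLW0' : 1 ≤ LW := by linarith
  have v3 : stepC ^ 2 * (g / R) ≤ stepC ^ 2 * (g * LW) := by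
    refine mul_le_mul_of_nonneg_left ?_ (by positivity)
    calc g / R ≤ g / 1 := div_le_div_of_nonneg_left hg0 one_pos hR
      _ ≤ g * LW := by rw [div_one]; exact le_mul_of_one_le_right hg0 hLW0'
  have hLW0 : 1 ≤ LW := by linarith
  have hC21 : 1 ≤ stepC ^ 2 := by nlinarith
  have v4 : stepC * (g * Λ) ≤ stepC ^ 2 * (g * Λ * LW) := by
    calc stepC * (g * Λ) ≤ stepC ^ 2 * (g * Λ) := mul_le_mul_of_nonneg_right hC2 m4
      _ ≤ stepC ^ 2 * (g * Λ * LW) :=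
          mul_le_mul_of_nonneg_left (le_mul_of_one_le_right m4 hLW0) (by positivity)
  have v5 : g * Λ ^ 2 * R ≤ stepC ^ 2 * (g * Λ ^ 2 * R * LW) := by
    have h1 : g * Λ ^ 2 * R ≤ g * Λ ^ 2 * R * LW := le_mul_of_one_le_right m5 hLW0
    have h2 : g * Λ ^ 2 * R * LW ≤ stepC ^ 2 * (g * Λ ^ 2 * R * LW) :=
      le_mul_of_one_le_left (by positivity) hC21
    linarith
  have w1 : 0 ≤ stepC ^ 2 * (g * LW / (Λ * R)) := by positivity
  have w2 : 0 ≤ stepC ^ 2 * (g * Λ * LW) := by positivity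
  have w3 : 0 ≤ stepC ^ 2 * (g * Λ ^ 2 * R * LW) := by positivity
  have w4 : 0 ≤ stepC ^ 2 * (g * LW) := by positivity
  linarith [hE, hT, v1, v2, v3, v4, v5]

end LineErrScale

/-! ### The transverse term in scale form -/

section TransScale

variable {νm Λ₂ r nd ne Lφ G L₂ κ₁ κ₂ Lb Λ R g : ℝ}

set_option maxHeartbeats 400000 in
/-- The amplitude variation `δ_A` in scale form: `δ_A ≤ 45·10⁶ C_S g/(R√Λ)`. [folklore] -/
theorem scale_deltaA (hr : 0 < r) (hG0 : 0 ≤ G) (hLφ0 : 0 ≤ Lφ) (hL20 : 0 ≤ L₂) (hΛ20 : 0 ≤ Λ₂)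
    (hnd0 : 0 ≤ nd) (hne0 : 0 ≤ ne) (hR : 1 ≤ R) (hΛ : 0 < Λ) (hg : G ≤ g)
    (hr1 : Λ / 400 ≤ r) (hΛ2 : Λ₂ ≤ 2 * Λ) (hnd : nd ≤ 2) (hne : ne ≤ 2)
    (hLφ : Lφ ≤ 200 * stepC * g / R) (hL2 : L₂ ≤ 16 * Λ / R) :
    (ne + (Λ₂ / r + 1) * nd) * (Lφ / Real.sqrt (2 * π * r) + π * G * L₂ / ((2 * π * r) * Real.sqrt (2 * π * r)))
      ≤ 45 * 10 ^ 6 * stepC * (g / (R * Real.sqrt Λ)) := by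
  have hπ := Real.pi_gt_d2
  have hπ' := Real.pi_lt_d2
  have hC := one_le_stepC
  have hg0 : 0 ≤ g := hG0.trans hg
  have hR0 : 0 < R := by linarith
  have hsΛ : 0 < Real.sqrt Λ := Real.sqrt_pos.2 hΛ
  have h1r : 1 / (2 * π * r) ≤ 64 / Λ := inv_two_pi_r_le hΛ hr1
  have h1r' : 1 / r ≤ 400 / Λ := by rw [div_le_div_iff₀ hr hΛ]; linarith
  have hsq : 1 / Real.sqrt (2 * π * r) ≤ 8 / Real.sqrt Λ := inv_sqrt_two_pi_r_le hΛ hr1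
  have hsq0 : 0 < Real.sqrt (2 * π * r) := Real.sqrt_pos.2 (by positivity)
  -- first factor
  have hf1 : ne + (Λ₂ / r + 1) * nd ≤ 1604 := by
    have h1 : Λ₂ / r ≤ 800 := by
      rw [div_eq_mul_one_div]
      calc Λ₂ * (1 / r) ≤ (2 * Λ) * (400 / Λ) := by gcongr
        _ = 800 := by field_simp; ring
    have h2 : (Λ₂ / r + 1) * nd ≤ 801 * 2 := mul_le_mul (by linarith) hnd hnd0 (by positivity)
    linarith
  have hf10 : 0 ≤ ne + (Λ₂ / r + 1) * nd := by positivity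
  -- second factor
  set Y := g / (R * Real.sqrt Λ) with hY
  have hY0 : 0 ≤ Y := by positivity
  have hs1 : Lφ / Real.sqrt (2 * π * r) ≤ 1600 * stepC * Y := by
    rw [div_eq_mul_one_div Lφ]
    calc Lφ * (1 / Real.sqrt (2 * π * r)) ≤ (200 * stepC * g / R) * (8 / Real.sqrt Λ) := by gcongr
      _ = 1600 * stepC * Y := by rw [hY]; field_simp; ring
  have hs2 : π * G * L₂ / ((2 * π * r) * Real.sqrt (2 * π * r)) ≤ 25805 * Y := by
    have e1 : π * G * L₂ / ((2 * π * r) * Real.sqrt (2 * π * r))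
        = π * G * L₂ * (1 / (2 * π * r)) * (1 / Real.sqrt (2 * π * r)) := by
      field_simp
    rw [e1]
    calc π * G * L₂ * (1 / (2 * π * r)) * (1 / Real.sqrt (2 * π * r))
        ≤ 315 / 100 * g * (16 * Λ / R) * (64 / Λ) * (8 / Real.sqrt Λ) := by gcongr; linarith
      _ = 258048 / 10 * Y := by rw [hY]; field_simp; ring
      _ ≤ 25805 * Y := by nlinarith
  have hs : Lφ / Real.sqrt (2 * π * r) + π * G * L₂ / ((2 * π * r) * Real.sqrt (2 * π * r))
      ≤ 27405 * (stepC * Y) := by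
    have : Y ≤ stepC * Y := le_mul_of_one_le_left hY0 hC
    linarith
  have hs0 : 0 ≤ Lφ / Real.sqrt (2 * π * r) + π * G * L₂ / ((2 * π * r) * Real.sqrt (2 * π * r)) := by positivity
  calc (ne + (Λ₂ / r + 1) * nd) * (Lφ / Real.sqrt (2 * π * r) + π * G * L₂ / ((2 * π * r) * Real.sqrt (2 * π * r)))
      ≤ 1604 * (27405 * (stepC * Y)) := mul_le_mul hf1 hs hs0 (by norm_num)
    _ ≤ 45 * 10 ^ 6 * stepC * Y := by nlinarith [mul_nonneg (by linarith : (0:ℝ) ≤ stepC) hY0]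
    _ = 45 * 10 ^ 6 * stepC * (g / (R * Real.sqrt Λ)) := by rw [hY]

set_option maxHeartbeats 400000 in
/-- The second-difference bracket in scale form:
`12(h L_b √μ + 1/√μ) + 1 ≤ 35·10¹⁰ R√Λ + 6576/√Λ + 1`. [folklore] -/
theorem scale_bracket (hκ₁ : 0 < κ₁) (hκ₁₂ : κ₁ ≤ κ₂) (hR : 1 ≤ R) (hΛ : 0 < Λ)
    (hκ1 : Λ / 150000 ≤ κ₁) (hκ2 : κ₂ ≤ 400 * Λ) (hLb0 : 0 ≤ Lb) (hLb : Lb ≤ 16 * R) :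
    12 * ((κ₂ + κ₁ / 2) / (κ₁ / 2) * Lb * Real.sqrt (κ₁ / 2) + 1 / Real.sqrt (κ₁ / 2)) + 1
      ≤ 35 * 10 ^ 10 * (R * Real.sqrt Λ) + 6576 * (1 / Real.sqrt Λ) + 1 := by
  have hR0 : 0 < R := by linarith
  have hsΛ : 0 < Real.sqrt Λ := Real.sqrt_pos.2 hΛ
  have hμ0 : 0 < κ₁ / 2 := by linarith
  have hsμ0 : 0 < Real.sqrt (κ₁ / 2) := Real.sqrt_pos.2 hμ0
  -- `hh ≤ 1.2·10⁸ + 1`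
  have hhh : (κ₂ + κ₁ / 2) / (κ₁ / 2) ≤ 12 * 10 ^ 7 + 1 := by
    rw [div_le_iff₀ hμ0]; nlinarith
  have hκ₂0 : 0 ≤ κ₂ := by linarith
  have hhh0 : 0 ≤ (κ₂ + κ₁ / 2) / (κ₁ / 2) := by positivity
  -- `√μ ≤ 15 √Λ`
  have hsμ : Real.sqrt (κ₁ / 2) ≤ 15 * Real.sqrt Λ := by
    rw [show (15 : ℝ) = Real.sqrt 225 by rw [show (225:ℝ) = 15 ^ 2 by norm_num, Real.sqrt_sq (by norm_num)],
      ← Real.sqrt_mul (by norm_num)]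
    exact Real.sqrt_le_sqrt (by linarith)
  -- `1/√μ ≤ 548/√Λ`
  have hisμ : 1 / Real.sqrt (κ₁ / 2) ≤ 548 * (1 / Real.sqrt Λ) := by
    have h1 : Real.sqrt Λ ≤ 548 * Real.sqrt (κ₁ / 2) := by
      rw [show (548 : ℝ) = Real.sqrt (548 ^ 2) by rw [Real.sqrt_sq (by norm_num)], ← Real.sqrt_mul (by norm_num)]
      exact Real.sqrt_le_sqrt (by nlinarith)
    rw [mul_one_div, div_le_div_iff₀ hsμ0 hsΛ]
    linarith
  have hmain : (κ₂ + κ₁ / 2) / (κ₁ / 2) * Lb * Real.sqrt (κ₁ / 2) ≤ (12 * 10 ^ 7 + 1) * (16 * R) * (15 * Real.sqrt Λ) := by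
    gcongr
  have : (12 * 10 ^ 7 + 1) * (16 * R) * (15 * Real.sqrt Λ) ≤ 29 * 10 ^ 9 * (R * Real.sqrt Λ) := by
    have : 0 ≤ R * Real.sqrt Λ := by positivity
    nlinarith
  nlinarith [hmain, hisμ, this]

end TransScale

/-- Arithmetic for the transverse term. [folklore] -/
theorem scale_e2 {Λ R : ℝ} (hR : 1 ≤ R) (hΛ : 0 < Λ) :
    (4 * (Λ * R) + 3) * (35 * 10 ^ 10 * R + 6576 * (1 / Λ) + 1 / Real.sqrt Λ)
      ≤ 142 * 10 ^ 10 * R * (Λ * R + 1 + 1 / (Λ * R)) := by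
  have hR0 : 0 < R := by linarith
  have hΛR : 0 < Λ * R := by positivity
  have hsΛ : 0 < Real.sqrt Λ := Real.sqrt_pos.2 hΛ
  have hsq1 : Real.sqrt Λ ≤ 1 + Λ := sqrt_le_one_add hΛ.le
  have hsq2 : 1 / Real.sqrt Λ ≤ 1 + 1 / Λ := one_div_sqrt_le hΛ
  have hΛ' : Real.sqrt Λ * Real.sqrt Λ = Λ := Real.mul_self_sqrt hΛ.le
  have hΛs : Λ / Real.sqrt Λ = Real.sqrt Λ := by rw [div_eq_iff hsΛ.ne', hΛ']
  have s2 : Λ ≤ Λ * R := le_mul_of_one_le_right hΛ.le hR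
  have hinv : 1 / Λ = R / (Λ * R) := by field_simp
  have a1 : (4 * (Λ * R)) * (1 / Real.sqrt Λ) = 4 * R * Real.sqrt Λ := by
    rw [show (4 * (Λ * R)) * (1 / Real.sqrt Λ) = 4 * R * (Λ / Real.sqrt Λ) by ring, hΛs]
  have a2 : 4 * R * Real.sqrt Λ ≤ 4 * R * (1 + Λ * R) :=
    mul_le_mul_of_nonneg_left (hsq1.trans (by linarith)) (by positivity)
  have a3 : 3 * (1 / Real.sqrt Λ) ≤ 3 * (R + R / (Λ * R)) := by
    refine mul_le_mul_of_nonneg_left (hsq2.trans ?_) (by norm_num)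
    rw [hinv]; linarith
  have t1 : (4 * (Λ * R) + 3) * (1 / Real.sqrt Λ) ≤ 4 * R * (1 + Λ * R) + 3 * (R + R / (Λ * R)) := by
    have : (4 * (Λ * R) + 3) * (1 / Real.sqrt Λ) = (4 * (Λ * R)) * (1 / Real.sqrt Λ) + 3 * (1 / Real.sqrt Λ) := by
      ring
    rw [this, a1]; linarith
  have t2 : (4 * (Λ * R) + 3) * (6576 * (1 / Λ)) = 26304 * R + 19728 * (R / (Λ * R)) := by field_simp; ring
  have t3 : (4 * (Λ * R) + 3) * (35 * 10 ^ 10 * R) = 140 * 10 ^ 10 * R * (Λ * R) + 105 * 10 ^ 10 * R := by ring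
  have hRΛR : 0 ≤ R / (Λ * R) := by positivity
  have hRR : 0 ≤ R * (Λ * R) := by positivity
  have e : 142 * 10 ^ 10 * R * (Λ * R + 1 + 1 / (Λ * R))
      = 142 * 10 ^ 10 * (R * (Λ * R)) + 142 * 10 ^ 10 * R + 142 * 10 ^ 10 * (R / (Λ * R)) := by
    ring
  have split : (4 * (Λ * R) + 3) * (35 * 10 ^ 10 * R + 6576 * (1 / Λ) + 1 / Real.sqrt Λ)
      = (4 * (Λ * R) + 3) * (35 * 10 ^ 10 * R) + (4 * (Λ * R) + 3) * (6576 * (1 / Λ))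
        + (4 * (Λ * R) + 3) * (1 / Real.sqrt Λ) := by ring
  rw [split, t3, t2, e]
  nlinarith

/-- Arithmetic for the final combination. [folklore] -/
theorem scale_final {Λ R g LW : ℝ} (hR : 1 ≤ R) (hΛ : 0 < Λ) (hg0 : 0 ≤ g) (hLW : 4 ≤ LW) :
    (16 * R) * (14 * 10 ^ 14 * stepC ^ 2 * g * LW * (1 + 1 / (Λ * R) + Λ + Λ ^ 2 * R))
        + 216 * 10 ^ 7 * stepC * g * (142 * 10 ^ 10 * R * (Λ * R + 1 + 1 / (Λ * R)))
      ≤ pieceK * stepC ^ 2 * LW * (g * R) * (Λ * R + Λ ^ 2 * R + 1 + 1 / (Λ * R)) := by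
  have hC := one_le_stepC
  have hR0 : 0 < R := by linarith
  have hΛR : 0 < Λ * R := by positivity
  rw [pieceK]
  have hC2 : stepC ≤ stepC ^ 2 := by nlinarith
  have p1 : 0 ≤ stepC ^ 2 * LW * (g * R) := by positivity
  have q0 : 0 ≤ g * R * (Λ * R + 1 + 1 / (Λ * R)) := by positivity
  have s1 : stepC * g * (142 * 10 ^ 10 * R * (Λ * R + 1 + 1 / (Λ * R)))
      ≤ stepC ^ 2 * (LW / 4) * (g * R) * (142 * 10 ^ 10 * (Λ * R + 1 + 1 / (Λ * R))) := by
    rw [show stepC * g * (142 * 10 ^ 10 * R * (Λ * R + 1 + 1 / (Λ * R)))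
        = stepC * 1 * (142 * 10 ^ 10) * (g * R * (Λ * R + 1 + 1 / (Λ * R))) by ring,
      show stepC ^ 2 * (LW / 4) * (g * R) * (142 * 10 ^ 10 * (Λ * R + 1 + 1 / (Λ * R)))
        = stepC ^ 2 * (LW / 4) * (142 * 10 ^ 10) * (g * R * (Λ * R + 1 + 1 / (Λ * R))) by ring]
    refine mul_le_mul_of_nonneg_right (mul_le_mul_of_nonneg_right ?_ (by norm_num)) q0
    exact mul_le_mul hC2 (by linarith) zero_le_one (by positivity)
  have s2 : Λ ≤ Λ * R := le_mul_of_one_le_right hΛ.le hR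
  have hmono : stepC ^ 2 * LW * (g * R) * (1 + 1 / (Λ * R) + Λ + Λ ^ 2 * R)
      ≤ stepC ^ 2 * LW * (g * R) * (Λ * R + Λ ^ 2 * R + 1 + 1 / (Λ * R)) :=
    mul_le_mul_of_nonneg_left (by linarith) p1
  have x2 : stepC ^ 2 * (LW / 4) * (g * R) * (142 * 10 ^ 10 * (Λ * R + 1 + 1 / (Λ * R)))
      ≤ stepC ^ 2 * LW * (g * R) * (Λ * R + Λ ^ 2 * R + 1 + 1 / (Λ * R)) * (355 * 10 ^ 9) := by
    rw [show stepC ^ 2 * (LW / 4) * (g * R) * (142 * 10 ^ 10 * (Λ * R + 1 + 1 / (Λ * R)))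
        = stepC ^ 2 * LW * (g * R) * (Λ * R + 1 + 1 / (Λ * R)) * (355 * 10 ^ 9) by ring]
    refine mul_le_mul_of_nonneg_right (mul_le_mul_of_nonneg_left ?_ p1) (by norm_num)
    nlinarith
  have e1 : (16 * R) * (14 * 10 ^ 14 * stepC ^ 2 * g * LW * (1 + 1 / (Λ * R) + Λ + Λ ^ 2 * R))
      = 224 * 10 ^ 14 * (stepC ^ 2 * LW * (g * R) * (1 + 1 / (Λ * R) + Λ + Λ ^ 2 * R)) := by ring
  have e2 : 216 * 10 ^ 7 * stepC * g * (142 * 10 ^ 10 * R * (Λ * R + 1 + 1 / (Λ * R)))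
      = 216 * 10 ^ 7 * (stepC * g * (142 * 10 ^ 10 * R * (Λ * R + 1 + 1 / (Λ * R)))) := by ring
  rw [e1, e2]
  have x1 : 0 ≤ stepC ^ 2 * LW * (g * R) * (Λ * R + Λ ^ 2 * R + 1 + 1 / (Λ * R)) := by positivity
  nlinarith

/-! ### The piece bound in scale form -/

namespace PieceHyp

variable {T : Set ℂ} {d e : ℂ} {F Fd Fe Fdd Fde Fee Fddd : ℂ → ℝ} {φ φd φdd : ℂ → ℝ}
  {r A Λ₂ Λ₃ κ₁ κ₂ L₂ G Lφ δ₀ lam3 G₁ G₂ νm : ℝ}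
  (P : PieceHyp T d e F Fd Fe Fdd Fde Fee Fddd φ φd φdd r A Λ₂ Λ₃ κ₁ κ₂ L₂ G Lφ δ₀ lam3 G₁ G₂ νm)
include P

set_option maxHeartbeats 800000 in
/-- **The piece bound in scale form.**  Under `PieceHyp` and the scale hypotheses (see the module docstring),
`‖∑_{b₁ ≤ b ≤ b₂} ∑_a φ(ad+be) e(F(ad+be))‖ ≤ K C_S² (log(1 + ΛR²) + 4) (gR) (ΛR + Λ²R + 1 + 1/(ΛR))`,
`K = pieceK = 10²²`. [cite: Titchmarsh1935Lattice] [cite: Kratzel1988, §2.2] -/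
theorem norm_piece_le_scale {b₁ b₂ : ℤ} (hb : b₁ ≤ b₂)
    (hrange : ∀ b : ℤ, (P.H.chord b).Nonempty → b₁ ≤ b ∧ b ≤ b₂) {ℓ : ℝ} (hℓ0 : 0 ≤ ℓ)
    (hchord : ∀ b : ℤ, (P.H.chord b).Nonempty → P.H.hi b - P.H.lo b ≤ ℓ) {z₀ : ℂ} (hz₀ : z₀ ∈ T)
    {Λ R g : ℝ} (hR : 1 ≤ R) (hΛ : 0 < Λ) (hg : G ≤ g)
    (hr1 : Λ / 400 ≤ r) (hAr : A * r ≤ 2 * Λ) (hA : A ≤ 400) (hl3 : lam3 ≤ 8 * Λ / R)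
    (hG1 : G₁ ≤ 300 * stepC * g / R) (hG2 : G₂ ≤ 80000 * stepC ^ 2 * g / R ^ 2)
    (hLφ : Lφ ≤ 200 * stepC * g / R) (hL2 : L₂ ≤ 16 * Λ / R) (hν : νm ≤ 2 * Λ * R)
    (hκ1 : Λ / 150000 ≤ κ₁) (hκ2 : κ₂ ≤ 400 * Λ) (hΛ2 : Λ₂ ≤ 2 * Λ)
    (hd : ‖d‖ ≤ 2) (he : ‖e‖ ≤ 2) (hℓ : ℓ ≤ 9 * R) (hLb : (b₂ : ℝ) - b₁ + 1 ≤ 16 * R) :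
    ‖∑ b ∈ Finset.Icc b₁ b₂, ∑' a : ℤ, (φ ((a : ℂ) * d + (b : ℂ) * e) : ℂ) * VdC.e (F ((a : ℂ) * d + (b : ℂ) * e))‖
      ≤ pieceK * stepC ^ 2 * (Real.log (1 + Λ * R ^ 2) + 4) * (g * R) * (Λ * R + Λ ^ 2 * R + 1 + 1 / (Λ * R)) := by
  have hC := one_le_stepC
  obtain ⟨hlam3, hG₁0, hG₂0, hνm0⟩ := P.consts_nonneg hz₀
  have hr := P.hr
  have hA1 := P.hA
  have hG0 := P.hG
  have hg0 : 0 ≤ g := hG0.trans hg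
  have hR0 : 0 < R := by linarith
  have hΛR : 0 < Λ * R := by positivity
  have hsΛ : 0 < Real.sqrt Λ := Real.sqrt_pos.2 hΛ
  have hLb0 : (0 : ℝ) ≤ (b₂ : ℝ) - b₁ + 1 := by
    have : (b₁ : ℝ) ≤ b₂ := by exact_mod_cast hb
    linarith
  set LW := Real.log (1 + Λ * R ^ 2) + 4 with hLW
  have hLW1 : 4 ≤ LW := by
    have : 0 ≤ Real.log (1 + Λ * R ^ 2) := Real.log_nonneg (by nlinarith [sq_nonneg R])
    linarith
  -- the two parts
  have h0 := P.norm_piece_le hb hrange hℓ0 hchord hz₀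
  have hLE := lineErr_le_scale hr hA1 hG0 hlam3 hG₁0 hG₂0 hR hΛ hg hr1 hAr hA hl3 hG1 hG2 hℓ0 hℓ
  have hδ := scale_deltaA (nd := ‖d‖) (ne := ‖e‖) hr hG0 P.hLφ P.hL₂ P.hΛ₂ (norm_nonneg _) (norm_nonneg _)
    hR hΛ hg hr1 hΛ2 hd he hLφ hL2
  have hbr := scale_bracket P.hκ₁ P.hκ₁₂ hR hΛ hκ1 hκ2 hLb0 hLb
  have hfr := norm_fresnelC_le_three
  -- ### the line part
  set Br := (1 + 1 / (Λ * R) + Λ + Λ ^ 2 * R) with hBr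
  have hBr0 : 0 ≤ Br := by positivity
  have hline : ((b₂ : ℝ) - b₁ + 1) * lineErr ℓ r A lam3 G G₁ G₂ ≤ (16 * R) * (14 * 10 ^ 14 * stepC ^ 2 * g * LW * Br) :=
    mul_le_mul hLb hLE (lineErr_nonneg hℓ0 hr hA1 hlam3 hG0 hG₁0 hG₂0) (by positivity)
  -- ### the transverse part
  set δA := (‖e‖ + (Λ₂ / r + 1) * ‖d‖) * (Lφ / Real.sqrt (2 * π * r) + π * G * L₂ / ((2 * π * r) * Real.sqrt (2 * π * r)))
    with hδA
  set brk := 12 * ((κ₂ + κ₁ / 2) / (κ₁ / 2) * ((b₂ : ℝ) - b₁ + 1) * Real.sqrt (κ₁ / 2) + 1 / Real.sqrt (κ₁ / 2)) + 1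
    with hbrk
  have hδA0 : 0 ≤ δA := by
    have := P.H.sM_nonneg; have := P.hLφ; have := P.hL₂; positivity
  have hbrk0 : 0 ≤ brk := by
    have := P.hκ₁; have : 0 ≤ κ₂ + κ₁ / 2 := by linarith [P.hκ₁₂]
    positivity
  have hN : 2 * νm + 3 ≤ 4 * (Λ * R) + 3 := by linarith
  have hN0 : 0 ≤ 2 * νm + 3 := by linarith
  have htr : ‖_root_.Literature.Analysis.Fourier.fresnelC‖ * ((2 * νm + 3) * (δA * ((b₂ : ℝ) - b₁ + 1) * brk))
      ≤ 3 * ((4 * (Λ * R) + 3) * (45 * 10 ^ 6 * stepC * (g / (R * Real.sqrt Λ))) * (16 * R)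
          * (35 * 10 ^ 10 * (R * Real.sqrt Λ) + 6576 * (1 / Real.sqrt Λ) + 1)) := by
    refine mul_le_mul hfr ?_ (by positivity) (by norm_num)
    rw [show (4 * (Λ * R) + 3) * (45 * 10 ^ 6 * stepC * (g / (R * Real.sqrt Λ))) * (16 * R)
          * (35 * 10 ^ 10 * (R * Real.sqrt Λ) + 6576 * (1 / Real.sqrt Λ) + 1)
        = (4 * (Λ * R) + 3) * ((45 * 10 ^ 6 * stepC * (g / (R * Real.sqrt Λ))) * (16 * R)
          * (35 * 10 ^ 10 * (R * Real.sqrt Λ) + 6576 * (1 / Real.sqrt Λ) + 1)) by ring]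
    refine mul_le_mul hN ?_ (by positivity) (by positivity)
    exact mul_le_mul (mul_le_mul hδ hLb hLb0 (by positivity)) hbr hbrk0 (by positivity)
  -- ### simplify the transverse bound
  have hΛ' : Real.sqrt Λ * Real.sqrt Λ = Λ := Real.mul_self_sqrt hΛ.le
  have hΛ'' : 1 / Λ = 1 / (Real.sqrt Λ * Real.sqrt Λ) := by rw [hΛ']
  have e1 : 3 * ((4 * (Λ * R) + 3) * (45 * 10 ^ 6 * stepC * (g / (R * Real.sqrt Λ))) * (16 * R)
          * (35 * 10 ^ 10 * (R * Real.sqrt Λ) + 6576 * (1 / Real.sqrt Λ) + 1))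
      = 216 * 10 ^ 7 * stepC * g *
          ((4 * (Λ * R) + 3) * (35 * 10 ^ 10 * R + 6576 * (1 / Λ) + 1 / Real.sqrt Λ)) := by
    rw [hΛ'']
    field_simp
    ring
  have e2 := scale_e2 hR hΛ
  have htr' : ‖_root_.Literature.Analysis.Fourier.fresnelC‖ * ((2 * νm + 3) * (δA * ((b₂ : ℝ) - b₁ + 1) * brk))
      ≤ 216 * 10 ^ 7 * stepC * g * (142 * 10 ^ 10 * R * (Λ * R + 1 + 1 / (Λ * R))) := by
    rw [e1] at htr
    exact htr.trans (mul_le_mul_of_nonneg_left e2 (by positivity))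
  -- ### combine
  have hfinal := scale_final hR hΛ hg0 hLW1
  rw [← hBr] at hfinal
  calc ‖∑ b ∈ Finset.Icc b₁ b₂, ∑' a : ℤ, (φ ((a : ℂ) * d + (b : ℂ) * e) : ℂ) * VdC.e (F ((a : ℂ) * d + (b : ℂ) * e))‖
      ≤ ((b₂ : ℝ) - b₁ + 1) * lineErr ℓ r A lam3 G G₁ G₂
        + ‖_root_.Literature.Analysis.Fourier.fresnelC‖ * ((2 * νm + 3) * (δA * ((b₂ : ℝ) - b₁ + 1) * brk)) := h0
    _ ≤ (16 * R) * (14 * 10 ^ 14 * stepC ^ 2 * g * LW * Br)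
        + 216 * 10 ^ 7 * stepC * g * (142 * 10 ^ 10 * R * (Λ * R + 1 + 1 / (Λ * R))) := add_le_add hline htr'
    _ ≤ _ := hfinal

end PieceHyp


end VdC
end Literature.NumberTheory.LFunctions

end
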